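import Summits.KontsevichZagierPeriods.KontsevichZagierPeriods.Theorems.SoloBlindQuarticS3Prep
import HarnessLib

/-!
# Quartic family, second kind, pattern `(½-x, 4x, 3/2-3x)` — preparations

Sol Binde (solo-blind track), 2026-08-20.

The remaining second-kind splitting of the Aoki–Shioda quartic family on the quartic
correspondence of `SoloBlindQuarticPrep` (`D = m(m²-m+1)`, `A = 1-D`, `Φ = D³/A⁴`; branches
`φ_A`, `φ_B`, `ψ`).  With the common factor `Λ = Φ^{-x} D^{1/2}` the three Beta integrands pull
back to

* `β(4x, 3/2-3x)` along `φ_A`  ↦ `G_A = Λ·(3m²-2m+1)/A`,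
* `β(½-x, 4x)` along `φ_B`     ↦ `G_B = Λ·(m²-2m+3)/(A(m²-m+1))`  (`=` the `G'_B` of the twist),
* `β(3/2-3x, x)` along `ψ`     ↦ `G_C = 64^{-x}·Λ·8(1+m)/((1-m)(1+m²)²)`,

and with the explicit algebraic primitive

  `P(m) = -2Λm²/(1+m²) = -2·m^{5/2-3x}(1-m)^{4x}(m²-m+1)^{1/2-3x}(1+m²)^{4x-1}`,

continuous on `[0,1]` and vanishing at both ends for `0 < x < 1/2`, one has on `(0,1)`

  `P' = (1-6x)·G_B + (1+2x)·G_A - ((1-4x)/2)·64^{x}·G_C`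

(one Newton–Leibniz correction, found by exact linear algebra).  This file: pull-backs,
integrability, semialgebraicity on the open interval, the primitive and its derivative; the
assembly in `Q` is `SoloBlindQuarticS1`.
-/

open MeasureTheory Set Real MvPolynomial
open Literature.NumberTheory.Transcendental
open Literature.NumberTheory.Transcendental.KZ
open Literature.NumberTheory.Transcendental.KZ.IntegralRep

noncomputable section

namespace Summit.KontsevichZagierPeriods.KontsevichZagierPeriods.Theorems

namespace SoloBlind

variable {x : ℚ}

/-! ## The common factor, the pulled-back integrands, the exact integrand, the primitive -/

/-- `Λ(x,m) = Φ^{-x} D^{1/2}`. -/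
def qjL (x : ℚ) (m : ℝ) : ℝ := quPhi m ^ (-(x : ℝ)) * quD m ^ (1 / 2 : ℝ)

/-- `G_A = Λ·(3m²-2m+1)/A`. -/
def qjGA (x : ℚ) (m : ℝ) : ℝ := qjL x m * (3 * m ^ 2 - 2 * m + 1) / quA m

/-- `G_B = Λ·(m²-2m+3)/(A(m²-m+1))`. -/
def qjGB (x : ℚ) (m : ℝ) : ℝ := qjL x m * (m ^ 2 - 2 * m + 3) / (quA m * (m ^ 2 - m + 1))

/-- `G_C = 64^{-x}·Λ·8(1+m)/((1-m)(1+m²)²)`. -/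
def qjGC (x : ℚ) (m : ℝ) : ℝ :=
  (64:ℝ) ^ (-(x : ℝ)) * (qjL x m * (8 * (1 + m)) / ((1 - m) * (1 + m ^ 2) ^ 2))

/-- The exact integrand `P' = (1-6x)G_B + (1+2x)G_A - ((1-4x)/2)64^{x}G_C` on `(0,1)`, extended
by `0`. -/
def qjE (x : ℚ) (m : ℝ) : ℝ :=
  if m ∈ Ioo (0:ℝ) 1 then
    (((-((1 - 4 * x) / 2) : ℚ)) : ℝ) * (64:ℝ) ^ (x : ℝ) * qjGC x m +
      (((((1 - 6 * x) : ℚ)) : ℝ) * qjGB x m + ((((1 + 2 * x) : ℚ)) : ℝ) * qjGA x m)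
  else 0

/-- The primitive (continuous form)
`P = -2·m^{5/2-3x}(1-m)^{4x}(m²-m+1)^{1/2-3x}(1+m²)^{4x-1}`. -/
def qjP (x : ℚ) (m : ℝ) : ℝ :=
  -(2 * (m ^ (5 / 2 - 3 * (x : ℝ)) * (1 - m) ^ (4 * (x : ℝ))) *
    ((m ^ 2 - m + 1) ^ (1 / 2 - 3 * (x : ℝ)) * (1 + m ^ 2) ^ (4 * (x : ℝ) - 1)))

/-! ## The pull-back identities -/

/-- **Pull-back along `φ_A`:** `G_A = σ^{4x-1}(1-σ)^{1/2-3x}|φ_A'|`, `σ = φ_A(m)`. -/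
theorem qj_pullA (x : ℚ) {m : ℝ} (hm : m ∈ Ioo (0:ℝ) 1) :
    qjGA x m = betaFun (4 * x) (3 / 2 - 3 * x) (quA m) * |quA' m| := by
  have hA := quA_pos hm
  have hD := quD_pos hm
  have hΦ := quPhi_pos hm
  rw [betaFun, show (((4 * x : ℚ)) : ℝ) - 1 = ((4:ℤ) : ℝ) * (x : ℝ) + (-1) by push_cast; ring,
    show (((3 / 2 - 3 * x : ℚ)) : ℝ) - 1 = ((-3:ℤ) : ℝ) * (x : ℝ) + (1 / 2 : ℝ) by
      push_cast; ring,
    one_sub_quA, qu_master hA hD, qt_keyA hm, Real.inv_rpow hΦ.le, ← Real.rpow_neg hΦ.le,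
    Real.rpow_neg_one, abs_quA']
  unfold qjGA qjL
  rw [div_eq_mul_inv]
  ring

/-- `G_B` is the twist integrand `G'_B` (`D^{1/2}/(m²-m+1) = m/D^{1/2}`). -/
theorem qjGB_eq_qtGB (x : ℚ) {m : ℝ} (hm : m ∈ Ioo (0:ℝ) 1) : qjGB x m = qtGB x m := by
  have hA := (quA_pos hm).ne'
  have hD := quD_pos hm
  have he := (ReflectionThird.sq_sub_add_one_pos m).ne'
  have hw : quD m ^ (1 / 2 : ℝ) ≠ 0 := (Real.rpow_pos_of_pos hD _).ne'
  have hsq : quD m ^ (1 / 2 : ℝ) * quD m ^ (1 / 2 : ℝ) = m * (m ^ 2 - m + 1) := by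
    rw [← Real.sqrt_eq_rpow]; exact Real.mul_self_sqrt hD.le
  unfold qjGB qjL qtGB
  rw [Real.sqrt_eq_rpow, div_eq_div_iff (mul_ne_zero hA he) (mul_ne_zero hA hw)]
  linear_combination (quPhi m ^ (-(x : ℝ)) * (m ^ 2 - 2 * m + 3) * quA m) * hsq

/-- **Pull-back along `φ_B`:** `G_B = σ^{-x-1/2}(1-σ)^{4x-1}|φ_B'|`, `σ = φ_B(m)`. -/
theorem qj_pullB (x : ℚ) {m : ℝ} (hm : m ∈ Ioo (0:ℝ) 1) :
    qjGB x m = betaFun (1 / 2 - x) (4 * x) (quB m) * |quB' m| := by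
  rw [qjGB_eq_qtGB x hm]
  exact qt_pullB x hm

/-- **Pull-back along `ψ`:** `G_C = s^{1/2-3x}(1-s)^{x-1}|ψ'|`, `s = ψ(m)`. -/
theorem qj_pullC (x : ℚ) {m : ℝ} (hm : m ∈ Ioo (0:ℝ) 1) :
    qjGC x m = betaFun (3 / 2 - 3 * x) x (quS m) * |quS' m| := by
  have hS := quS_mem hm
  have h1S := one_sub_quS_pos hm
  have hΦ := quPhi_pos hm
  have h1 : (1:ℝ) - m ≠ 0 := by linarith [hm.2]
  have hP : (1:ℝ) + m ^ 2 ≠ 0 := by positivity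
  rw [betaFun, show (((3 / 2 - 3 * x : ℚ)) : ℝ) - 1 = ((-3:ℤ) : ℝ) * (x : ℝ) + (1 / 2 : ℝ) by
      push_cast; ring,
    show ((x : ℚ) : ℝ) - 1 = ((1:ℤ) : ℝ) * (x : ℝ) + (-1) by push_cast; ring,
    qu_master hS.1 h1S, qt_keyC hm, Real.inv_rpow (by positivity),
    Real.mul_rpow (by norm_num) hΦ.le, mul_inv, ← Real.rpow_neg hΦ.le,
    ← Real.rpow_neg (by norm_num : (0:ℝ) ≤ 64), Real.rpow_neg_one, ← Real.sqrt_eq_rpow,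
    qt_sqrt_quS hm, Real.sqrt_eq_rpow, one_sub_quS, abs_of_pos (quS'_pos hm)]
  unfold qjGC qjL quS' quD
  field_simp
  ring

/-! ## Integrability -/

/-- `G_A` is integrable on `(0,1)` for `0 < x < 1/2`. -/
theorem integrableOn_qjGA (x : ℚ) (hx : 0 < x) (hx2 : 2 * x < 1) :
    IntegrableOn (qjGA x) (Ioo 0 1) := by
  have h := integrableOn_betaFun (4 * x) (3 / 2 - 3 * x) (by positivity) (by linarith)
  rw [image_quA, integrableOn_image_iff_integrableOn_abs_deriv_smul measurableSet_Ioo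
    (fun m _ => (hasDerivAt_quA m).hasDerivWithinAt) injOn_quA] at h
  exact h.congr_fun (fun m hm => by simp only [smul_eq_mul]; rw [mul_comm, ← qj_pullA x hm])
    measurableSet_Ioo

/-- `G_B` is integrable on `(0,1)` for `0 < x < 1/2`. -/
theorem integrableOn_qjGB (x : ℚ) (hx : 0 < x) (hx2 : 2 * x < 1) :
    IntegrableOn (qjGB x) (Ioo 0 1) := by
  have h := integrableOn_betaFun (1 / 2 - x) (4 * x) (by linarith) (by positivity)
  rw [image_quB, integrableOn_image_iff_integrableOn_abs_deriv_smul measurableSet_Ioo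
    (fun m _ => (hasDerivAt_quB m).hasDerivWithinAt) injOn_quB] at h
  exact h.congr_fun (fun m hm => by simp only [smul_eq_mul]; rw [mul_comm, ← qj_pullB x hm])
    measurableSet_Ioo

/-- `G_C` is integrable on `(0,1)` for `0 < x < 1/2`. -/
theorem integrableOn_qjGC (x : ℚ) (hx : 0 < x) (hx2 : 2 * x < 1) :
    IntegrableOn (qjGC x) (Ioo 0 1) := by
  have h := integrableOn_betaFun (3 / 2 - 3 * x) x (by linarith) hx
  rw [image_quS, integrableOn_image_iff_integrableOn_abs_deriv_smul measurableSet_Ioo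
    (fun m _ => (hasDerivAt_quS m).hasDerivWithinAt) injOn_quS] at h
  exact h.congr_fun (fun m hm => by simp only [smul_eq_mul]; rw [mul_comm, ← qj_pullC x hm])
    measurableSet_Ioo

/-! ## Semialgebraicity on the open interval -/

/-- `Φ^{-x} · D^{1/2} · p(m) / r(m)` is `ℚ`-semialgebraic on `(0,1)` for polynomials `p`, `r`
with `r ≠ 0` there. -/
theorem sa_qj_shape (x : ℚ) (p r : MvPolynomial (Fin 1) ℚ)
    (hr : ∀ v ∈ line (Ioo (0:ℝ) 1), aeval v r ≠ 0) :
    IsSemialgebraicFunOn ℚ (line (Ioo (0:ℝ) 1))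
      (fun v : Fin 1 → ℝ =>
        quPhi (v 0) ^ (-(x : ℝ)) * quD (v 0) ^ (1 / 2 : ℝ) * aeval v p / aeval v r) := by
  have hD : IsSemialgebraicFunOn ℚ (line (Ioo (0:ℝ) 1))
      (fun v : Fin 1 → ℝ => quD (v 0) ^ (1 / 2 : ℝ)) :=
    (sa_quD_rpow (1 / 2)).congr fun v _ => by push_cast; rfl
  exact IsSemialgebraicFunOn.div
    (IsSemialgebraicFunOn.mul_holds (IsSemialgebraicFunOn.mul_holds
      ((sa_quPhi_rpow (-x)).congr fun v _ => by push_cast; rfl) hD)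
      (isSemialgebraicFunOn_aeval mix_line_sa p))
    (isSemialgebraicFunOn_aeval mix_line_sa r) hr

/-- `G_A` is `ℚ`-semialgebraic on `(0,1)`. -/
theorem sa_qjGA (x : ℚ) :
    IsSemialgebraicFunOn ℚ (line (Ioo (0:ℝ) 1)) (fun v : Fin 1 → ℝ => qjGA x (v 0)) :=
  (sa_qj_shape x (3 * X 0 ^ 2 - 2 * X 0 + 1) ((1 - X 0) * (1 + X 0 ^ 2))
    qt_aeval_A_ne_zero).congr fun v _ => by simp [qjGA, qjL, quA]

/-- `G_B` is `ℚ`-semialgebraic on `(0,1)`. -/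
theorem sa_qjGB (x : ℚ) :
    IsSemialgebraicFunOn ℚ (line (Ioo (0:ℝ) 1)) (fun v : Fin 1 → ℝ => qjGB x (v 0)) :=
  (sa_qtGB x).congr fun v hv => by
    have hv' : v 0 ∈ Ioo (0:ℝ) 1 := hv
    simp [qjGB_eq_qtGB x hv']

/-- `G_C` is `ℚ`-semialgebraic on `(0,1)`. -/
theorem sa_qjGC (x : ℚ) :
    IsSemialgebraicFunOn ℚ (line (Ioo (0:ℝ) 1)) (fun v : Fin 1 → ℝ => qjGC x (v 0)) :=
  (IsSemialgebraicFunOn.mul_holds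
    (isSemialgebraicFunOn_const_of_isAlgebraic mix_line_sa (qu_isAlgebraic_rpow (-x)))
    (sa_qj_shape x (8 * (1 + X 0)) ((1 - X 0) * (1 + X 0 ^ 2) ^ 2) fun v hv => by
      have h0 : v 0 ∈ Ioo (0:ℝ) 1 := hv
      have : (0:ℝ) < (1 - v 0) * (1 + v 0 ^ 2) ^ 2 := by
        have : (0:ℝ) < 1 - v 0 := by linarith [h0.2]
        positivity
      simpa using this.ne')).congr fun v _ => by simp [qjGC, qjL, mul_div_assoc]

/-- The exact integrand is `ℚ`-semialgebraic on the OPEN interval. -/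
theorem sa_qjE_Ioo (x : ℚ) :
    IsSemialgebraicFunOn ℚ (line (Ioo (0:ℝ) 1)) (fun v : Fin 1 → ℝ => qjE x (v 0)) := by
  refine (((isSemialgebraicFunOn_const_of_isAlgebraic mix_line_sa
      (isAlgebraic_rat ℚ (-((1 - 4 * x) / 2)))).mul_holds
      ((isSemialgebraicFunOn_const_of_isAlgebraic mix_line_sa
        (qu_isAlgebraic_rpow x)).mul_holds (sa_qjGC x))).add_holds
    (((isSemialgebraicFunOn_const_of_isAlgebraic mix_line_sa
      (isAlgebraic_rat ℚ (1 - 6 * x))).mul_holds (sa_qjGB x)).add_holds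
      ((isSemialgebraicFunOn_const_of_isAlgebraic mix_line_sa
        (isAlgebraic_rat ℚ (1 + 2 * x))).mul_holds (sa_qjGA x)))).congr fun v hv => ?_
  have hv' : v 0 ∈ Ioo (0:ℝ) 1 := hv
  simp only [qjE, if_pos hv', Pi.add_apply, Pi.mul_apply]
  push_cast
  ring

/-! ## The primitive -/

/-- `P(0) = 0` (`x < 1/2`). -/
theorem qjP_zero (hx2 : 2 * x < 1) : qjP x 0 = 0 := by
  have h : (5 / 2 - 3 * (x : ℝ)) ≠ 0 := by
    have : (2 * x : ℝ) < 1 := by exact_mod_cast hx2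
    intro h; linarith
  simp [qjP, Real.zero_rpow h]

/-- `P(1) = 0` (`0 < x`). -/
theorem qjP_one (hx : 0 < x) : qjP x 1 = 0 := by
  have h : (4 * (x : ℝ)) ≠ 0 := by positivity
  simp [qjP, Real.zero_rpow h]

/-- `P` is continuous (`0 < x < 1/2`). -/
theorem continuous_qjP (hx : 0 < x) (hx2 : 2 * x < 1) : Continuous (qjP x) := by
  have h1 : (0:ℝ) ≤ 5 / 2 - 3 * (x : ℝ) := by
    have : (2 * x : ℝ) < 1 := by exact_mod_cast hx2
    linarith
  have h2 : (0:ℝ) ≤ 4 * (x : ℝ) := by positivity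
  unfold qjP
  refine (Continuous.mul ?_ ?_).neg
  · exact ((Continuous.rpow_const continuous_id fun _ => Or.inr h1).mul
      (Continuous.rpow_const (by fun_prop) fun _ => Or.inr h2)).const_mul _
  · exact (Continuous.rpow_const (by fun_prop) fun m =>
        Or.inl (ReflectionThird.sq_sub_add_one_pos m).ne').mul
      (Continuous.rpow_const (by fun_prop) fun m => Or.inl (by positivity))

/-- On `(0,1)`: `P = Λ · (-2m²/(1+m²))`. -/
theorem qjP_eq {m : ℝ} (hm : m ∈ Ioo (0:ℝ) 1) :
    qjP x m = qjL x m * (-(2 * m ^ 2) / (1 + m ^ 2)) := by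
  have hA := quA_pos hm
  have hD := quD_pos hm
  have hΦ := quPhi_pos hm
  have h0 := hm.1
  have h1 : (0:ℝ) < 1 - m := by linarith [hm.2]
  have he := ReflectionThird.sq_sub_add_one_pos m
  have h2 : (0:ℝ) < 1 + m ^ 2 := by positivity
  unfold qjL
  rw [Real.rpow_neg hΦ.le, show quPhi m = quD m ^ 3 / quA m ^ 4 from rfl,
    Real.div_rpow (pow_nonneg hD.le 3) (pow_nonneg hA.le 4), ← Real.rpow_natCast (quD m) 3,
    ← Real.rpow_mul hD.le, ← Real.rpow_natCast (quA m) 4, ← Real.rpow_mul hA.le,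
    show quA m = (1 - m) * (1 + m ^ 2) from rfl, show quD m = m * (m ^ 2 - m + 1) from rfl,
    Real.mul_rpow h1.le h2.le, Real.mul_rpow h0.le he.le, Real.mul_rpow h0.le he.le]
  unfold qjP
  rw [show (5 / 2 - 3 * (x : ℝ)) = (2 + 1 / 2) - 3 * (x : ℝ) by ring, Real.rpow_sub h0,
    Real.rpow_add h0, Real.rpow_two, Real.rpow_sub he, Real.rpow_sub_one h2.ne']
  push_cast
  have hp1 := Real.rpow_pos_of_pos h2 (4 * (x:ℝ))
  have hp2 := Real.rpow_pos_of_pos h0 (3 * (x:ℝ))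
  have hp3 := Real.rpow_pos_of_pos he (3 * (x:ℝ))
  have hp4 := Real.rpow_pos_of_pos h1 (4 * (x:ℝ))
  have hp5 := Real.rpow_pos_of_pos h0 (1 / 2 : ℝ)
  have hp6 := Real.rpow_pos_of_pos he (1 / 2 : ℝ)
  field_simp

/-- `Λ' = Λ·(-xΦ'/Φ + D'/(2D))` on `(0,1)`. -/
theorem hasDerivAt_qjL {m : ℝ} (hm : m ∈ Ioo (0:ℝ) 1) :
    HasDerivAt (qjL x) (qjL x m * (-(x : ℝ) * (quPhi' m / quPhi m) +
      (3 * m ^ 2 - 2 * m + 1) / (2 * quD m))) m := by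
  have hΦ := quPhi_pos hm
  have hD := quD_pos hm
  refine (((hasDerivAt_quPhi hm).rpow_const (p := -(x : ℝ)) (Or.inl hΦ.ne')).mul
    ((hasDerivAt_quD m).rpow_const (p := (1 / 2 : ℝ)) (Or.inl hD.ne'))).congr_deriv ?_
  unfold qjL
  rw [Real.rpow_sub_one hΦ.ne', Real.rpow_sub_one hD.ne']
  field_simp

/-- **`P' = (1-6x)G_B + (1+2x)G_A - ((1-4x)/2)64^{x}G_C` on `(0,1)`** — the Newton–Leibniz
identity of the remaining second-kind quartic splitting. -/
theorem hasDerivAt_qjP {m : ℝ} (hm : m ∈ Ioo (0:ℝ) 1) : HasDerivAt (qjP x) (qjE x m) m := by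
  obtain ⟨h0, h1⟩ := hm
  have hΦ := quPhi_pos ⟨h0, h1⟩
  have hA := (quA_pos ⟨h0, h1⟩).ne'
  have hD := (quD_pos ⟨h0, h1⟩).ne'
  have he := (ReflectionThird.sq_sub_add_one_pos m).ne'
  have h2 : (1:ℝ) + m ^ 2 ≠ 0 := by positivity
  have h2' : (1:ℝ) + m * m ≠ 0 := by positivity
  have h64 : (64:ℝ) ^ (x : ℝ) ≠ 0 := by positivity
  have hid := hasDerivAt_id' m
  have hsq := hid.mul hid
  have hρ := ((hsq.const_mul 2).neg).div (hsq.const_add 1) h2'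
  have hF : qjP x =ᶠ[nhds m] fun v => qjL x v * (-(2 * (v * v)) / (1 + v * v)) :=
    Filter.eventually_iff_exists_mem.mpr ⟨Ioo 0 1, Ioo_mem_nhds h0 h1, fun v hv => by
      rw [qjP_eq hv]; ring⟩
  refine ((((hasDerivAt_qjL ⟨h0, h1⟩).mul hρ).congr_of_eventuallyEq hF)).congr_deriv ?_
  simp only [Pi.mul_apply, Pi.div_apply, Pi.neg_apply]
  rw [qjE, if_pos ⟨h0, h1⟩]
  simp only [qjGA, qjGB, qjGC]
  rw [Real.rpow_neg (by norm_num : (0:ℝ) ≤ 64) (x : ℝ)]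
  set L := qjL x m with hL
  have key : L * (-(x : ℝ) * (quPhi' m / quPhi m) + (3 * m ^ 2 - 2 * m + 1) / (2 * quD m)) =
      L * (-(x : ℝ) * ((3 * m ^ 2 - 2 * m + 1) * (3 * quA m + 4 * quD m) / (quA m * quD m)) +
        (3 * m ^ 2 - 2 * m + 1) / (2 * quD m)) := by
    rw [← quPhi'_div ⟨h0, h1⟩]
  rw [key]
  unfold quA quD at *
  have h1m : (1:ℝ) - m ≠ 0 := by linarith
  push_cast
  set q := m ^ 2 - m + 1 with hq
  field_simp
  rw [hq]
  ring

end SoloBlind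

end Summit.KontsevichZagierPeriods.KontsevichZagierPeriods.Theorems
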